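import Summits.NavierStokesRegularity.OSWSelfSimilar.SheetRCentreOfRecord
import Summits.NavierStokesRegularity.OSWSelfSimilar.SheetRBackboneFrame
import Summits.NavierStokesRegularity.OSWSelfSimilar.SheetREnergyClass
import HarnessLib

/-!
# SHEET-ℝ frame: the RESIDUAL of a frame centre is weighted square-integrable — hypothesis-ledger row #8's non-interval half
# (`hG`) DISCHARGED for the centre of record

HONEST FRAMING (cell ns-blowup GROUP B / zone Z3, cases Z3-SR-CERT + Z3-SR-SPEC; 1-D MODEL certificate (viscous gCLM/OSW sheet on the line at
`(a, c_l, ε) = (1/5, 1/2, 1)`); computer-assisted; not Euler/NS; «violates: none — MODEL»).  Nothing here asserts that a profile exists; no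
interval sentence is proved; no number of record moves.

The existence row (`SheetRCertificateAssemblyB.existsUnique_weakSolutionB`) and every word built on it (`certifiedProfile_word(_ofRecord)`,
`SheetRTranslationModeOfRecord.translationMode_word_ofRecord`, …) carry the hypothesis
`hG : Integrable ((L²+y²)·G(Ω̄)(y)²)`, `G(Ω̄) = Ω̄ + ½ξΩ̄₁ + a·𝒰Ω̄·Ω̄₁ − HΩ̄·Ω̄ − Ω̄₁′` — the square-integrability that makes the residual bound
`√∫(L²+y²)G(Ω̄)² ≤ etaB2` (row #8, an interval sentence) meaningful.  For the TYPED centre of record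
(`SheetRCentreOfRecord.centreOfRecord = frameCentre 8 767 centreCoeff centreAlpha2`) it is a THEOREM: a frame centre
`Ω = Σ_{i<N} d_i e_{i+1} + α·L²T₂` and its derivative decay like `(L²+ξ²)⁻¹`, and so do `ξΩ₁` and `Ω₁′` (closed rational forms of `e_n′`, `e_n″` from
`SheetRBackboneFrame`; the far-field shape's second derivative `S″(s) = 3s(2s²−3)(1+s²)^{−7/2}` here), while `𝒰Ω` and `HΩ` are bounded
(`SheetREnergyClass.abs_velocity_le_of_primitive`, `IsCentre.hilbert_le`); hence `|G(Ω)(ξ)| ≤ C/(L²+ξ²)` and `SheetRFrameCentre.integrable_weight_sq_of_le`.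
* §1 far field: `shapeSDeriv2`, `hasDerivAt_shapeSDeriv`, `abs_shapeSDeriv2_le` (`≤ 9/(1+s²)`), `abs_mul_shapeSDeriv_le` (`|s·S′(s)| ≤ 2/(1+s²)`),
  `hasDerivAt_farT2Deriv`, bounds for `ξ·T₂′` and `T₂″`;
* §2 frame: `frameDeriv_eq` (the trig form of `SheetRFrameCentre.frameDeriv` = the rational form of `SheetRBackboneFrame`), `abs_mul_frameDeriv_le`
  (`|ξ e_n′| ≤ (2n+4)L²/(L²+ξ²)`), `hasDerivAt_frameDeriv` + `abs_frameDeriv2_le` (`|e_n″| ≤ (20+12n+8n²)/(L²+ξ²)`);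
* §3 centre: `abs_mul_frameCentreDeriv_le`, `hasDerivAt_frameCentreDeriv`, `abs_deriv_frameCentreDeriv_le`;
* §4 `integrable_weight_residual_sq_frameCentre` (any `a`) and `integrable_weight_residual_sq_centreOfRecord` (`a = 1/5`) = `hG` OF RECORD.
Pure calculus about explicit functions; no definition of a new object beyond the two closed-form derivative abbreviations; no named fact.
WHAT THIS IS NOT: not NS; not the interval half of row #8 (`etaB2`).
-/

noncomputable section

namespace Summit.NavierStokesRegularity.OSWSelfSimilar
namespace SheetRFrameCentreResidual

open _root_.MeasureTheory _root_.Set _root_.Filter _root_.Real Literature.Analysis.Fourier SheetRCayleySubstitution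
  SheetRFarFieldT2 SheetRFarFieldHilbert SheetRCertificateAssembly SheetRFrameCentre SheetRCentreOfRecord
open scoped Topology

/-! ### §1 The far-field shape: second derivative and decay of `ξ·T₂′`, `T₂″` -/

/-- `S″(s) = 3s(2s² − 3)/((1 + s²)³√(1 + s²))` — the second derivative of the far-field shape `S(s) = s(1+s²)^{−3/2}`. [folklore] -/
def shapeSDeriv2 (s : ℝ) : ℝ := 3 * s * (2 * s ^ 2 - 3) / ((1 + s ^ 2) ^ 3 * √(1 + s ^ 2))

/-- `S′` has derivative `S″` (write `S′ = (1 − 2s²)·((1+s²)^{−1/2})⁵` and use `((1+s²)^{−1/2})′ = −s(1+s²)^{−3/2}`). [folklore] -/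
theorem hasDerivAt_shapeSDeriv (s : ℝ) : HasDerivAt shapeSDeriv (shapeSDeriv2 s) s := by
  have hfun : shapeSDeriv = fun y => (1 - 2 * y ^ 2) * ((√(1 + y ^ 2))⁻¹) ^ 5 := by
    funext z
    rw [shapeSDeriv]
    set u := √(1 + z ^ 2) with hu
    have hu0 : u ≠ 0 := by rw [hu]; positivity
    have hu2 : 1 + z ^ 2 = u * u := (sqrt_one_add_sq_mul_self z).symm
    rw [hu2]
    field_simp
  rw [hfun]
  have hp : HasDerivAt (fun y : ℝ => 1 - 2 * y ^ 2) (-(4 * s)) s := by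
    have h := ((hasDerivAt_pow 2 s).const_mul 2).const_sub 1
    refine h.congr_deriv ?_
    push_cast; ring
  have hprod := hp.mul ((hasDerivAt_invSqrt s).fun_pow 5)
  have e : ((fun y : ℝ => 1 - 2 * y ^ 2) * fun y => (√(1 + y ^ 2))⁻¹ ^ 5) = fun y => (1 - 2 * y ^ 2) * ((√(1 + y ^ 2))⁻¹) ^ 5 :=
    funext fun y => rfl
  rw [e] at hprod
  refine hprod.congr_deriv ?_
  rw [shapeSDeriv2]
  set u := √(1 + s ^ 2) with hu
  have hu0 : u ≠ 0 := by rw [hu]; positivity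
  have hu2 : 1 + s ^ 2 = u * u := (sqrt_one_add_sq_mul_self s).symm
  rw [hu2]
  push_cast
  field_simp
  linear_combination (4 * s) * hu2

/-- `|S″(s)| ≤ 9/(1 + s²)`. [folklore] -/
theorem abs_shapeSDeriv2_le (s : ℝ) : |shapeSDeriv2 s| ≤ 9 / (1 + s ^ 2) := by
  have hq : 0 < 1 + s ^ 2 := by positivity
  have hu : 0 < √(1 + s ^ 2) := Real.sqrt_pos.2 hq
  rw [shapeSDeriv2, abs_div, abs_of_pos (by positivity : (0:ℝ) < (1 + s ^ 2) ^ 3 * √(1 + s ^ 2)),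
    div_le_div_iff₀ (by positivity) hq]
  have hs : |s| ≤ √(1 + s ^ 2) := Real.abs_le_sqrt (by nlinarith)
  have h1 : |2 * s ^ 2 - 3| ≤ 3 * (1 + s ^ 2) := by
    rw [abs_le]; constructor <;> nlinarith [sq_nonneg s]
  have h2 : |3 * s * (2 * s ^ 2 - 3)| ≤ 3 * √(1 + s ^ 2) * (3 * (1 + s ^ 2)) := by
    rw [abs_mul, abs_mul, abs_of_pos (by norm_num : (0:ℝ) < 3)]
    gcongr
  have hq1 : (1 : ℝ) ≤ 1 + s ^ 2 := by nlinarith [sq_nonneg s]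
  calc |3 * s * (2 * s ^ 2 - 3)| * (1 + s ^ 2) ≤ 3 * √(1 + s ^ 2) * (3 * (1 + s ^ 2)) * (1 + s ^ 2) := by gcongr
    _ = 9 * ((1 + s ^ 2) ^ 2 * 1 * √(1 + s ^ 2)) := by ring
    _ ≤ 9 * ((1 + s ^ 2) ^ 2 * (1 + s ^ 2) * √(1 + s ^ 2)) := by gcongr
    _ = 9 * ((1 + s ^ 2) ^ 3 * √(1 + s ^ 2)) := by ring

/-- `|s·S′(s)| ≤ 2/(1 + s²)`. [folklore] -/
theorem abs_mul_shapeSDeriv_le (s : ℝ) : |s * shapeSDeriv s| ≤ 2 / (1 + s ^ 2) := by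
  have hq : 0 < 1 + s ^ 2 := by positivity
  rw [shapeSDeriv, mul_div_assoc', abs_div, abs_of_pos (by positivity : (0:ℝ) < (1 + s ^ 2) ^ 2 * √(1 + s ^ 2)),
    div_le_div_iff₀ (by positivity) hq]
  have hs : |s| ≤ √(1 + s ^ 2) := Real.abs_le_sqrt (by nlinarith)
  have h1 : |1 - 2 * s ^ 2| ≤ 2 * (1 + s ^ 2) := by
    rw [abs_le]; constructor <;> nlinarith [sq_nonneg s]
  calc |s * (1 - 2 * s ^ 2)| * (1 + s ^ 2) = |s| * |1 - 2 * s ^ 2| * (1 + s ^ 2) := by rw [abs_mul]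
    _ ≤ √(1 + s ^ 2) * (2 * (1 + s ^ 2)) * (1 + s ^ 2) := by gcongr
    _ = 2 * ((1 + s ^ 2) ^ 2 * √(1 + s ^ 2)) := by ring

/-- `T₂″(ξ) = L⁻²·S″(ξ/L)/L²`. [folklore] -/
def farT2Deriv2 (L ξ : ℝ) : ℝ := (L ^ 2)⁻¹ * (shapeSDeriv2 (ξ / L) / L ^ 2)

/-- `T₂′` has derivative `T₂″`. [folklore] -/
theorem hasDerivAt_farT2Deriv {L : ℝ} (hL : 0 < L) (ξ : ℝ) : HasDerivAt (farT2Deriv L) (farT2Deriv2 L ξ) ξ := by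
  have hS : HasDerivAt shapeSDeriv (shapeSDeriv2 (ξ / L)) (ξ / L) := hasDerivAt_shapeSDeriv (ξ / L)
  have hdiv : HasDerivAt (fun ξ : ℝ => ξ / L) (1 / L) ξ := by simpa using (hasDerivAt_id ξ).div_const L
  have h := ((hS.comp ξ hdiv).div_const L).const_mul ((L ^ 2)⁻¹)
  have e : (fun x => (L ^ 2)⁻¹ * ((shapeSDeriv ∘ fun ξ : ℝ => ξ / L) x / L)) = farT2Deriv L := by
    funext x; simp only [farT2Deriv, Function.comp]
  rw [e] at h
  refine h.congr_deriv ?_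
  rw [farT2Deriv2]
  have hL0 : L ≠ 0 := hL.ne'
  field_simp

/-- `|L²·ξ·T₂′(ξ)| ≤ 2L²/(L² + ξ²)`. [folklore] -/
theorem abs_mul_farT2Deriv_le {L : ℝ} (hL : 0 < L) (ξ : ℝ) : |L ^ 2 * (ξ * farT2Deriv L ξ)| ≤ 2 * L ^ 2 / (L ^ 2 + ξ ^ 2) := by
  have hL0 : L ≠ 0 := hL.ne'
  have e : L ^ 2 * (ξ * farT2Deriv L ξ) = (ξ / L) * shapeSDeriv (ξ / L) := by
    rw [farT2Deriv]; field_simp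
  rw [e]
  have h := abs_mul_shapeSDeriv_le (ξ / L)
  have hs : 1 + (ξ / L) ^ 2 = (L ^ 2 + ξ ^ 2) / L ^ 2 := by field_simp
  rw [hs, div_div_eq_mul_div] at h
  exact h

/-- `|L²·T₂″(ξ)| ≤ 9/(L² + ξ²)`. [folklore] -/
theorem abs_farT2Deriv2_le {L : ℝ} (hL : 0 < L) (ξ : ℝ) : |L ^ 2 * farT2Deriv2 L ξ| ≤ 9 / (L ^ 2 + ξ ^ 2) := by
  have hL0 : L ≠ 0 := hL.ne'
  have hL2 : 0 < L ^ 2 := by positivity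
  rw [farT2Deriv2, ← mul_assoc, mul_inv_cancel₀ (pow_ne_zero 2 hL0), one_mul, abs_div, abs_of_pos hL2,
    div_le_div_iff₀ hL2 (by positivity)]
  have h := abs_shapeSDeriv2_le (ξ / L)
  have hs : 1 + (ξ / L) ^ 2 = (L ^ 2 + ξ ^ 2) / L ^ 2 := by field_simp
  rw [hs, div_div_eq_mul_div] at h
  calc |shapeSDeriv2 (ξ / L)| * (L ^ 2 + ξ ^ 2) ≤ 9 * L ^ 2 / (L ^ 2 + ξ ^ 2) * (L ^ 2 + ξ ^ 2) := by gcongr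
    _ = 9 * L ^ 2 := by field_simp

/-! ### §2 The frame functions: `ξ·e_n′` and `e_n″` decay like `(L² + ξ²)⁻¹` -/

/-- `|A·sin x + B·cos y| ≤ |A| + |B|`. [folklore] -/
theorem abs_sin_cos_comb_le (A B x y : ℝ) : |A * sin x + B * cos y| ≤ |A| + |B| := by
  refine (abs_add_le _ _).trans (add_le_add ?_ ?_)
  · rw [abs_mul]; exact mul_le_of_le_one_right (abs_nonneg _) (abs_sin_le_one _)
  · rw [abs_mul]; exact mul_le_of_le_one_right (abs_nonneg _) (abs_cos_le_one _)

/-- The trigonometric form `SheetRFrameCentre.frameDeriv` of `e_n′` equals the rational form of `SheetRBackboneFrame.hasDerivAt_frame`: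
`e_n′(ξ) = (−4L²ξ·sin nθ + 4nL³·cos nθ)/(L² + ξ²)²` (uniqueness of the derivative). [folklore] -/
theorem frameDeriv_eq {L : ℝ} (hL : L ≠ 0) (n : ℕ) (ξ : ℝ) :
    frameDeriv L n ξ = (-(4 * L ^ 2 * ξ) * sin (n * (2 * arctan (ξ / L))) + 4 * n * L ^ 3 * cos (n * (2 * arctan (ξ / L)))) /
      (L ^ 2 + ξ ^ 2) ^ 2 :=
  (SheetRFrameCentre.hasDerivAt_frame hL n ξ).unique (SheetRBackboneFrame.hasDerivAt_frame hL n ξ)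

/-- **`|ξ·e_n′(ξ)| ≤ (2n + 4)L²/(L² + ξ²)`** (`L > 0`). [folklore] -/
theorem abs_mul_frameDeriv_le {L : ℝ} (hL : 0 < L) (n : ℕ) (ξ : ℝ) :
    |ξ * frameDeriv L n ξ| ≤ (2 * n + 4) * L ^ 2 / (L ^ 2 + ξ ^ 2) := by
  have hw : 0 < L ^ 2 + ξ ^ 2 := by positivity
  have e : ξ * frameDeriv L n ξ =
      (-(4 * L ^ 2 * ξ ^ 2) * sin (n * (2 * arctan (ξ / L))) + 4 * n * L ^ 3 * ξ * cos (n * (2 * arctan (ξ / L))))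
        / (L ^ 2 + ξ ^ 2) ^ 2 := by
    rw [frameDeriv_eq hL.ne']; ring
  rw [e, abs_div, abs_of_pos (by positivity : (0:ℝ) < (L ^ 2 + ξ ^ 2) ^ 2), div_le_div_iff₀ (by positivity) hw]
  have h1 := abs_sin_cos_comb_le (-(4 * L ^ 2 * ξ ^ 2)) (4 * n * L ^ 3 * ξ) (n * (2 * arctan (ξ / L))) (n * (2 * arctan (ξ / L)))
  have h2 : |-(4 * L ^ 2 * ξ ^ 2)| = 4 * L ^ 2 * ξ ^ 2 := by rw [abs_neg, abs_of_nonneg (by positivity)]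
  have h3 : |4 * n * L ^ 3 * ξ| = 4 * n * L ^ 3 * |ξ| := by
    rw [abs_mul, abs_of_nonneg (by positivity)]
  have hξ : 2 * L * |ξ| ≤ L ^ 2 + ξ ^ 2 := by nlinarith [sq_nonneg (L - |ξ|), sq_abs ξ]
  have hn : (0 : ℝ) ≤ n := n.cast_nonneg
  have hA : 4 * L ^ 2 * ξ ^ 2 ≤ 4 * L ^ 2 * (L ^ 2 + ξ ^ 2) := by nlinarith [mul_nonneg (sq_nonneg L) (sq_nonneg L)]
  have hB : 4 * n * L ^ 3 * |ξ| ≤ 2 * n * L ^ 2 * (L ^ 2 + ξ ^ 2) := by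
    calc 4 * n * L ^ 3 * |ξ| = 2 * n * L ^ 2 * (2 * L * |ξ|) := by ring
      _ ≤ 2 * n * L ^ 2 * (L ^ 2 + ξ ^ 2) := mul_le_mul_of_nonneg_left hξ (by positivity)
  calc |-(4 * L ^ 2 * ξ ^ 2) * sin (n * (2 * arctan (ξ / L))) + 4 * n * L ^ 3 * ξ * cos (n * (2 * arctan (ξ / L)))| * (L ^ 2 + ξ ^ 2)
      ≤ (|-(4 * L ^ 2 * ξ ^ 2)| + |4 * n * L ^ 3 * ξ|) * (L ^ 2 + ξ ^ 2) := mul_le_mul_of_nonneg_right h1 hw.le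
    _ = (4 * L ^ 2 * ξ ^ 2 + 4 * n * L ^ 3 * |ξ|) * (L ^ 2 + ξ ^ 2) := by rw [h2, h3]
    _ ≤ (4 * L ^ 2 * (L ^ 2 + ξ ^ 2) + 2 * n * L ^ 2 * (L ^ 2 + ξ ^ 2)) * (L ^ 2 + ξ ^ 2) :=
        mul_le_mul_of_nonneg_right (add_le_add hA hB) hw.le
    _ = (2 * n + 4) * L ^ 2 * (L ^ 2 + ξ ^ 2) ^ 2 := by ring

/-- The second derivative `e_n″` in closed form (the value of `SheetRBackboneFrame.hasDerivAt_frame_deriv`). [folklore] -/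
def frameDeriv2 (L : ℝ) (n : ℕ) (ξ : ℝ) : ℝ :=
  ((-(4 * L ^ 2 * (L ^ 2 + ξ ^ 2)) - 8 * n ^ 2 * L ^ 4 + 16 * L ^ 2 * ξ ^ 2) * sin (n * (2 * arctan (ξ / L)))
    - 24 * n * L ^ 3 * ξ * cos (n * (2 * arctan (ξ / L)))) / (L ^ 2 + ξ ^ 2) ^ 3

/-- `e_n′` has derivative `e_n″`. [folklore] -/
theorem hasDerivAt_frameDeriv {L : ℝ} (hL : L ≠ 0) (n : ℕ) (ξ : ℝ) : HasDerivAt (frameDeriv L n) (frameDeriv2 L n ξ) ξ := by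
  have e : frameDeriv L n = fun ξ => (-(4 * L ^ 2 * ξ) * sin (n * (2 * arctan (ξ / L))) +
      4 * n * L ^ 3 * cos (n * (2 * arctan (ξ / L)))) / (L ^ 2 + ξ ^ 2) ^ 2 := funext (frameDeriv_eq hL n)
  rw [e]
  exact SheetRBackboneFrame.hasDerivAt_frame_deriv hL n ξ

/-- **`|e_n″(ξ)| ≤ (20 + 12n + 8n²)/(L² + ξ²)`** (`L > 0`). [folklore] -/
theorem abs_frameDeriv2_le {L : ℝ} (hL : 0 < L) (n : ℕ) (ξ : ℝ) :
    |frameDeriv2 L n ξ| ≤ (20 + 12 * n + 8 * n ^ 2) / (L ^ 2 + ξ ^ 2) := by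
  have hw : 0 < L ^ 2 + ξ ^ 2 := by positivity
  have e : frameDeriv2 L n ξ =
      ((-(4 * L ^ 2 * (L ^ 2 + ξ ^ 2)) - 8 * n ^ 2 * L ^ 4 + 16 * L ^ 2 * ξ ^ 2) * sin (n * (2 * arctan (ξ / L)))
        + (-(24 * n * L ^ 3 * ξ)) * cos (n * (2 * arctan (ξ / L)))) / (L ^ 2 + ξ ^ 2) ^ 3 := by
    rw [frameDeriv2]; ring
  rw [e, abs_div, abs_of_pos (by positivity : (0:ℝ) < (L ^ 2 + ξ ^ 2) ^ 3), div_le_div_iff₀ (by positivity) hw]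
  have h1 := abs_sin_cos_comb_le ((-(4 * L ^ 2 * (L ^ 2 + ξ ^ 2)) - 8 * n ^ 2 * L ^ 4 + 16 * L ^ 2 * ξ ^ 2))
    (-(24 * n * L ^ 3 * ξ)) (n * (2 * arctan (ξ / L))) (n * (2 * arctan (ξ / L)))
  have hn : (0 : ℝ) ≤ n := n.cast_nonneg
  have hξ : 2 * L * |ξ| ≤ L ^ 2 + ξ ^ 2 := by nlinarith [sq_nonneg (L - |ξ|), sq_abs ξ]
  have h2 : |(-(4 * L ^ 2 * (L ^ 2 + ξ ^ 2)) - 8 * n ^ 2 * L ^ 4 + 16 * L ^ 2 * ξ ^ 2)| ≤ (20 + 8 * n ^ 2) * L ^ 2 * (L ^ 2 + ξ ^ 2) := by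
    rw [abs_le]; constructor <;>
      nlinarith [sq_nonneg L, sq_nonneg ξ, mul_nonneg (sq_nonneg L) (sq_nonneg ξ), mul_nonneg (sq_nonneg L) (sq_nonneg L),
        mul_nonneg (mul_nonneg hn hn) (mul_nonneg (sq_nonneg L) (sq_nonneg ξ)),
        mul_nonneg (mul_nonneg hn hn) (mul_nonneg (sq_nonneg L) (sq_nonneg L))]
  have h3 : |(-(24 * n * L ^ 3 * ξ))| ≤ 12 * n * L ^ 2 * (L ^ 2 + ξ ^ 2) := by
    rw [abs_neg, abs_mul, abs_of_nonneg (by positivity : (0:ℝ) ≤ 24 * n * L ^ 3)]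
    calc 24 * n * L ^ 3 * |ξ| = 12 * n * L ^ 2 * (2 * L * |ξ|) := by ring
      _ ≤ 12 * n * L ^ 2 * (L ^ 2 + ξ ^ 2) := mul_le_mul_of_nonneg_left hξ (by positivity)
  have hL2 : L ^ 2 ≤ L ^ 2 + ξ ^ 2 := by nlinarith [sq_nonneg ξ]
  calc |(-(4 * L ^ 2 * (L ^ 2 + ξ ^ 2)) - 8 * n ^ 2 * L ^ 4 + 16 * L ^ 2 * ξ ^ 2) * sin (n * (2 * arctan (ξ / L)))
        + (-(24 * n * L ^ 3 * ξ)) * cos (n * (2 * arctan (ξ / L)))| * (L ^ 2 + ξ ^ 2)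
      ≤ (|(-(4 * L ^ 2 * (L ^ 2 + ξ ^ 2)) - 8 * n ^ 2 * L ^ 4 + 16 * L ^ 2 * ξ ^ 2)| + |(-(24 * n * L ^ 3 * ξ))|)
          * (L ^ 2 + ξ ^ 2) := mul_le_mul_of_nonneg_right h1 hw.le
    _ ≤ ((20 + 8 * n ^ 2) * L ^ 2 * (L ^ 2 + ξ ^ 2) + 12 * n * L ^ 2 * (L ^ 2 + ξ ^ 2)) * (L ^ 2 + ξ ^ 2) :=
        mul_le_mul_of_nonneg_right (add_le_add h2 h3) hw.le
    _ = (20 + 12 * n + 8 * n ^ 2) * (L ^ 2 * (L ^ 2 + ξ ^ 2) ^ 2) := by ring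
    _ ≤ (20 + 12 * n + 8 * n ^ 2) * ((L ^ 2 + ξ ^ 2) * (L ^ 2 + ξ ^ 2) ^ 2) := by
        have hk : (0:ℝ) ≤ 20 + 12 * n + 8 * n ^ 2 := by positivity
        exact mul_le_mul_of_nonneg_left (mul_le_mul_of_nonneg_right hL2 (by positivity)) hk
    _ = (20 + 12 * n + 8 * n ^ 2) * (L ^ 2 + ξ ^ 2) ^ 3 := by ring

/-! ### §3 The frame centre: `ξ·Ω₁` and `Ω₁′` -/

section Centre

variable {L : ℝ} (hL : 0 < L) (N : ℕ) (d : ℕ → ℝ) (α : ℝ)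
include hL

/-- **`|ξ·Ω₁(ξ)| ≤ (L²·Σ(2i + 6)|d_i| + 2L²|α|)/(L² + ξ²)`.** [folklore] -/
theorem abs_mul_frameCentreDeriv_le (ξ : ℝ) :
    |ξ * frameCentreDeriv L N d α ξ| ≤
      (L ^ 2 * (∑ i ∈ Finset.range N, (2 * (i + 1 : ℕ) + 4) * |d i|) + 2 * L ^ 2 * |α|) / (L ^ 2 + ξ ^ 2) := by
  have e : ξ * frameCentreDeriv L N d α ξ =
      (∑ i ∈ Finset.range N, d i * (ξ * frameDeriv L (i + 1) ξ)) + α * (L ^ 2 * (ξ * farT2Deriv L ξ)) := by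
    rw [frameCentreDeriv, mul_add, Finset.mul_sum]
    congr 1
    · exact Finset.sum_congr rfl fun i _ => by ring
    · ring
  rw [e, add_div, Finset.mul_sum, Finset.sum_div]
  refine (abs_add_le _ _).trans (add_le_add ((Finset.abs_sum_le_sum_abs _ _).trans (Finset.sum_le_sum fun i _ => ?_)) ?_)
  · rw [abs_mul]
    calc |d i| * |ξ * frameDeriv L (i + 1) ξ| ≤ |d i| * ((2 * (i + 1 : ℕ) + 4) * L ^ 2 / (L ^ 2 + ξ ^ 2)) :=
          mul_le_mul_of_nonneg_left (abs_mul_frameDeriv_le hL _ ξ) (abs_nonneg _)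
      _ = L ^ 2 * ((2 * (i + 1 : ℕ) + 4) * |d i|) / (L ^ 2 + ξ ^ 2) := by ring
  · rw [abs_mul]
    calc |α| * |L ^ 2 * (ξ * farT2Deriv L ξ)| ≤ |α| * (2 * L ^ 2 / (L ^ 2 + ξ ^ 2)) :=
          mul_le_mul_of_nonneg_left (abs_mul_farT2Deriv_le hL ξ) (abs_nonneg _)
      _ = 2 * L ^ 2 * |α| / (L ^ 2 + ξ ^ 2) := by ring

/-- The second derivative of the frame centre, `Ω₁′ = Σ d_i·e_{i+1}″ + α·L²·T₂″`. [folklore] -/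
def frameCentreDeriv2 (L : ℝ) (N : ℕ) (d : ℕ → ℝ) (α : ℝ) (ξ : ℝ) : ℝ :=
  (∑ i ∈ Finset.range N, d i * frameDeriv2 L (i + 1) ξ) + α * (L ^ 2 * farT2Deriv2 L ξ)

/-- `Ω₁` has derivative `Ω₁′`. [folklore] -/
theorem hasDerivAt_frameCentreDeriv (ξ : ℝ) :
    HasDerivAt (frameCentreDeriv L N d α) (frameCentreDeriv2 L N d α ξ) ξ := by
  have h1 : HasDerivAt (fun ξ => ∑ i ∈ Finset.range N, d i * frameDeriv L (i + 1) ξ)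
      (∑ i ∈ Finset.range N, d i * frameDeriv2 L (i + 1) ξ) ξ :=
    HasDerivAt.fun_sum fun i _ => (hasDerivAt_frameDeriv hL.ne' (i + 1) ξ).const_mul (d i)
  have h2 : HasDerivAt (fun ξ => α * (L ^ 2 * farT2Deriv L ξ)) (α * (L ^ 2 * farT2Deriv2 L ξ)) ξ :=
    ((hasDerivAt_farT2Deriv hL ξ).const_mul (L ^ 2)).const_mul α
  have e : frameCentreDeriv L N d α = fun ξ => (∑ i ∈ Finset.range N, d i * frameDeriv L (i + 1) ξ) + α * (L ^ 2 * farT2Deriv L ξ) :=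
    funext fun ξ => rfl
  rw [e]
  exact h1.add h2

/-- `deriv Ω₁ = Ω₁′`. [folklore] -/
theorem deriv_frameCentreDeriv : deriv (frameCentreDeriv L N d α) = frameCentreDeriv2 L N d α :=
  funext fun ξ => (hasDerivAt_frameCentreDeriv hL N d α ξ).deriv

/-- **`|Ω₁′(ξ)| ≤ (Σ(20 + 12(i+1) + 8(i+1)²)|d_i| + 9|α|)/(L² + ξ²)`.** [folklore] -/
theorem abs_frameCentreDeriv2_le (ξ : ℝ) :
    |frameCentreDeriv2 L N d α ξ| ≤
      ((∑ i ∈ Finset.range N, (20 + 12 * ((i + 1 : ℕ) : ℝ) + 8 * ((i + 1 : ℕ) : ℝ) ^ 2) * |d i|) + 9 * |α|) / (L ^ 2 + ξ ^ 2) := by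
  rw [frameCentreDeriv2, add_div, Finset.sum_div]
  refine (abs_add_le _ _).trans (add_le_add ((Finset.abs_sum_le_sum_abs _ _).trans (Finset.sum_le_sum fun i _ => ?_)) ?_)
  · rw [abs_mul]
    calc |d i| * |frameDeriv2 L (i + 1) ξ| ≤ |d i| * ((20 + 12 * ((i + 1 : ℕ) : ℝ) + 8 * ((i + 1 : ℕ) : ℝ) ^ 2) / (L ^ 2 + ξ ^ 2)) :=
          mul_le_mul_of_nonneg_left (abs_frameDeriv2_le hL _ ξ) (abs_nonneg _)
      _ = (20 + 12 * ((i + 1 : ℕ) : ℝ) + 8 * ((i + 1 : ℕ) : ℝ) ^ 2) * |d i| / (L ^ 2 + ξ ^ 2) := by ring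
  · rw [abs_mul]
    calc |α| * |L ^ 2 * farT2Deriv2 L ξ| ≤ |α| * (9 / (L ^ 2 + ξ ^ 2)) :=
          mul_le_mul_of_nonneg_left (abs_farT2Deriv2_le hL ξ) (abs_nonneg _)
      _ = 9 * |α| / (L ^ 2 + ξ ^ 2) := by ring

/-! ### §4 The residual is weighted square-integrable -/

/-- **`∫(L²+ξ²)·G(Ω)² < ∞` for a frame centre** `Ω = Σ_{i<N} d_i e_{i+1} + α·L²T₂` (`L > 0`, any `a`):
the residual `G(Ω) = Ω + ½ξΩ₁ + a·𝒰Ω·Ω₁ − HΩ·Ω − Ω₁′` (`Ω₁ = Ω′`, `𝒰Ω = ∫₀ HΩ`) is continuous and `|G(Ω)(ξ)| ≤ C/(L²+ξ²)`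
(`Ω, ξΩ₁, Ω₁, Ω₁′ = O((L²+ξ²)⁻¹)`, `|𝒰Ω| ≤ (π/4L)^{1/2}‖Ω‖_w`, `|HΩ| ≤ H₀`), hence weighted square-integrable
(`SheetRFrameCentre.integrable_weight_sq_of_le`). MODEL frame bookkeeping; not NS. [folklore] -/
theorem integrable_weight_residual_sq_frameCentre (a : ℝ) :
    Integrable fun y => (L ^ 2 + y ^ 2) * (frameCentre L N d α y + 1 / 2 * y * frameCentreDeriv L N d α y
      + a * (∫ s in (0 : ℝ)..y, hilbertTransform (frameCentre L N d α) s) * frameCentreDeriv L N d α y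
      - hilbertTransform (frameCentre L N d α) y * frameCentre L N d α y - deriv (frameCentreDeriv L N d α) y) ^ 2 := by
  set Ω : ℝ → ℝ := frameCentre L N d α with hΩdef
  set Ω₁ : ℝ → ℝ := frameCentreDeriv L N d α with hΩ₁def
  have hc : IsCentre L Ω Ω₁ (2 * (∑ i ∈ Finset.range N, |d i|) + 6 * |α| / π) := isCentre_frameCentre hL N d α
  obtain ⟨hΩc, hΩ₁2, hΩ2, hΩi, -⟩ := hc.basic hL
  -- continuity of the pieces
  have hΩ₁c : Continuous Ω₁ := (contDiff_frameCentreDeriv hL N d α (k := 0)).continuous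
  have hUc : Continuous fun ξ => ∫ s in (0 : ℝ)..ξ, hilbertTransform Ω s :=
    SheetRWeakProfilePV.continuous_velocity_of_primitive hc.primitive' hΩ₁2 hΩi hΩ2
  have hHc : Continuous (hilbertTransform Ω) :=
    SheetRWeakProfilePV.continuous_hilbertTransform_of_contDiff (contDiff_frameCentre hL N d α (k := 1)) hΩi
  have hΩ₁'c : Continuous (deriv Ω₁) := by
    rw [hΩ₁def, deriv_frameCentreDeriv hL N d α]
    exact (contDiff_frameCentreDeriv hL N d α (k := 1)).continuous_deriv le_rfl |>.congr
      (fun ξ => by rw [deriv_frameCentreDeriv hL N d α])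
  have hGc : Continuous fun y => Ω y + 1 / 2 * y * Ω₁ y + a * (∫ s in (0 : ℝ)..y, hilbertTransform Ω s) * Ω₁ y
      - hilbertTransform Ω y * Ω y - deriv Ω₁ y := by
    have := hΩc; have := hΩ₁c; have := hUc; have := hHc; have := hΩ₁'c
    fun_prop
  -- the constants
  set C₀ : ℝ := 2 * L ^ 2 * (∑ i ∈ Finset.range N, |d i|) + |α| * L ^ 2
  set C₁ : ℝ := 2 * L * (∑ i ∈ Finset.range N, (2 * (i + 1 : ℕ) + 1) * |d i|) + 2 * L * |α|
  set Ca : ℝ := L ^ 2 * (∑ i ∈ Finset.range N, (2 * (i + 1 : ℕ) + 4) * |d i|) + 2 * L ^ 2 * |α|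
  set Cb : ℝ := (∑ i ∈ Finset.range N, (20 + 12 * ((i + 1 : ℕ) : ℝ) + 8 * ((i + 1 : ℕ) : ℝ) ^ 2) * |d i|) + 9 * |α|
  set H₀ : ℝ := 2 * (∑ i ∈ Finset.range N, |d i|) + 6 * |α| / π
  set U₀ : ℝ := Real.sqrt (π / (4 * L)) * Real.sqrt (∫ y, (L ^ 2 + y ^ 2) * Ω y ^ 2)
  have hU : ∀ ξ, |∫ s in (0 : ℝ)..ξ, hilbertTransform Ω s| ≤ U₀ := fun ξ =>
    SheetREnergyClass.abs_velocity_le_of_primitive hL hc.primitive' hc.odd hc.measurable hc.weight₀ hc.weight₁ ξ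
  have hH : ∀ ξ, |hilbertTransform Ω ξ| ≤ H₀ := hc.hilbert_le
  have h0 : ∀ ξ, |Ω ξ| ≤ C₀ / (L ^ 2 + ξ ^ 2) := abs_frameCentre_le hL N d α
  have h1 : ∀ ξ, |Ω₁ ξ| ≤ C₁ / (L ^ 2 + ξ ^ 2) := abs_frameCentreDeriv_le hL N d α
  have ha : ∀ ξ, |ξ * Ω₁ ξ| ≤ Ca / (L ^ 2 + ξ ^ 2) := abs_mul_frameCentreDeriv_le hL N d α
  have hb : ∀ ξ, |deriv Ω₁ ξ| ≤ Cb / (L ^ 2 + ξ ^ 2) := fun ξ => by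
    rw [hΩ₁def, deriv_frameCentreDeriv hL N d α]; exact abs_frameCentreDeriv2_le hL N d α ξ
  have hU0 : 0 ≤ U₀ := by positivity
  have hH0 : 0 ≤ H₀ := le_trans (abs_nonneg _) (hH 0)
  -- the pointwise bound
  refine integrable_weight_sq_of_le hL hGc (C := C₀ + 1 / 2 * Ca + |a| * U₀ * C₁ + H₀ * C₀ + Cb) fun ξ => ?_
  have hw : 0 < L ^ 2 + ξ ^ 2 := by positivity
  have t1 := h0 ξ
  have t2 : |1 / 2 * ξ * Ω₁ ξ| ≤ 1 / 2 * (Ca / (L ^ 2 + ξ ^ 2)) := by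
    rw [mul_assoc, abs_mul, abs_of_pos (by norm_num : (0:ℝ) < 1 / 2)]
    exact mul_le_mul_of_nonneg_left (ha ξ) (by norm_num)
  have t3 : |a * (∫ s in (0 : ℝ)..ξ, hilbertTransform Ω s) * Ω₁ ξ| ≤ |a| * U₀ * (C₁ / (L ^ 2 + ξ ^ 2)) := by
    rw [abs_mul, abs_mul]
    exact mul_le_mul (mul_le_mul_of_nonneg_left (hU ξ) (abs_nonneg a)) (h1 ξ) (abs_nonneg _) (by positivity)
  have t4 : |hilbertTransform Ω ξ * Ω ξ| ≤ H₀ * (C₀ / (L ^ 2 + ξ ^ 2)) := by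
    rw [abs_mul]; exact mul_le_mul (hH ξ) (h0 ξ) (abs_nonneg _) hH0
  have t5 := hb ξ
  calc |Ω ξ + 1 / 2 * ξ * Ω₁ ξ + a * (∫ s in (0 : ℝ)..ξ, hilbertTransform Ω s) * Ω₁ ξ - hilbertTransform Ω ξ * Ω ξ - deriv Ω₁ ξ|
      ≤ |Ω ξ| + |1 / 2 * ξ * Ω₁ ξ| + |a * (∫ s in (0 : ℝ)..ξ, hilbertTransform Ω s) * Ω₁ ξ| + |hilbertTransform Ω ξ * Ω ξ|
          + |deriv Ω₁ ξ| := by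
        refine (abs_sub _ _).trans (add_le_add ((abs_sub _ _).trans (add_le_add ((abs_add_le _ _).trans
          (add_le_add (abs_add_le _ _) le_rfl)) le_rfl)) le_rfl)
    _ ≤ C₀ / (L ^ 2 + ξ ^ 2) + 1 / 2 * (Ca / (L ^ 2 + ξ ^ 2)) + |a| * U₀ * (C₁ / (L ^ 2 + ξ ^ 2)) + H₀ * (C₀ / (L ^ 2 + ξ ^ 2))
          + Cb / (L ^ 2 + ξ ^ 2) := by gcongr
    _ = (C₀ + 1 / 2 * Ca + |a| * U₀ * C₁ + H₀ * C₀ + Cb) / (L ^ 2 + ξ ^ 2) := by field_simp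

end Centre

/-- **`hG` OF RECORD: the residual of the centre of record is weighted square-integrable.** For the typed centre
`Ω̄ = centreOfRecord`, `Ω̄₁ = centreOfRecordDeriv` (`L = 8`, `a = 1/5`):
`∫ (64 + y²)·(Ω̄ + ½yΩ̄₁ + (1/5)𝒰Ω̄·Ω̄₁ − HΩ̄·Ω̄ − Ω̄₁′)² < ∞` — the hypothesis `hG` of `existsUnique_weakSolutionB`,
`certifiedProfile_word_ofRecord`, `translationMode_word_ofRecord` (hypothesis-ledger row #8's non-interval half) is a kernel fact.
MODEL statement; not NS. [folklore] -/
theorem integrable_weight_residual_sq_centreOfRecord :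
    Integrable fun y => ((8:ℝ) ^ 2 + y ^ 2) * (centreOfRecord y + 1 / 2 * y * centreOfRecordDeriv y
      + 1 / 5 * (∫ s in (0 : ℝ)..y, hilbertTransform centreOfRecord s) * centreOfRecordDeriv y
      - hilbertTransform centreOfRecord y * centreOfRecord y - deriv centreOfRecordDeriv y) ^ 2 :=
  integrable_weight_residual_sq_frameCentre (by norm_num) 767 centreCoeff centreAlpha2 (1 / 5)

end SheetRFrameCentreResidual
end Summit.NavierStokesRegularity.OSWSelfSimilar

end
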